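import Summits.AtomisticToContinuum.HydrodynamicLimit.Theorems.CollisionIsometryCLTMacroClosureEngineTrajectoryIntegrableA
import Summits.AtomisticToContinuum.HydrodynamicLimit.Theorems.CollisionIsometryCLTMacroClosureEngineIsentropic
import Summits.AtomisticToContinuum.HydrodynamicLimit.Theorems.CollisionIsometryCLTMacroClosureEngineIncrement
import HarnessLib

/-!
# Sub-goal `engine_trajectoryIntegrable` of the lead's `engine_incrementBound` (line `IdeatorTwoGen1Sketch`,
# crux `MacroClosure`, stmt-AtomisticToContinuum-14870): time-integrability along one good trajectory

For a classical hs-Euler solution `(ρ, u, θ)` on `[0, T)` in the dilute chamber of `ThermoChamber η₃`,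
`0 < t < T`, a band floor `c₁ > 0`, a smooth kernel `φ` and a good trajectory `τ ↦ w_τ := Φ_τ z` of a
hard-sphere flow whose blocks stay in the band `c₁ ≤ ρ̄ ≤ σ⁻³` on `[0, t]`, the seven functionals that the
increment bound integrates in time are integrable on `[0, t]`: the block production `prodBlock(τ, w_τ)`, the
classical production `prodCl(τ)`, the microscopic production `kinFlux(τ, w_τ)`, the collisional closure
`∫ₓ ccClosure(τ, w_τ, x) dx`, the kinetic defect `∫ₓ (Σ D² + |q|²)(w_τ)`, and the velocity moments
`⟨emp w_τ, 1 + |v|³⟩`, `⟨emp w_τ, e^{λ|v|²}⟩`.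

Proof. (a) `prodCl` is continuous on `[0, t] ⊂ [0, T)`: its integrand `∂τΛ·U_cl + Σⱼ ∂ⱼΛ·Fⱼ(U_cl)` is
jointly smooth (`IsSmoothSpaceTimeOn.continuousOn_integral`). (b) Velocity functionals
`⟨emp w_τ, g(v)⟩ = (N+1)⁻¹ Σᵢ g(vᵢ(τ))` and the microscopic production (whose weight is jointly continuous
in `(τ, x)` for every `v`; at interior times its two-sided time derivatives are the one-sided ones) are
integrable particle by particle (`traj_intervalIntegrable_vel`: velocities are constant between the finitely
many collision times). (c) The three BLOCK functionals are treated window by window: on a collision-free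
window `(a, b) ⊆ [0, t]` the trajectory agrees with the CONTINUOUS path of configurations
`W(s) = (xᵢ(clamp s), vᵢ(m))ᵢ` (positions clamped to `[a, b]`, velocities frozen at the midpoint `m`), all
of whose blocks lie in the band; along such a path every block field `ρ̄, m̄, Ē, ū, θ̄, D, q` is jointly
continuous in `(s, x)`, the block pressure `p̄ = ρ̄ θ̄ Z(ρ̄σ³)` is bounded and jointly measurable (`Z` is
measurable and bounded on the band by Ruelle convexity, `HsFreeEnergyConvex`), and the derivative fields
`∂τΛ, ∂ⱼΛ, div λᵐ, ∇λᴱ` are jointly continuous on `[0, t] × 𝕋³`; hence the integrands of `prodBlock`,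
`∫ₓ ccClosure` and of the kinetic defect are integrable on `[a, b] × 𝕋³`, and by Fubini
(`Integrable.integral_prod_left`) their space integrals are integrable in time on `[a, b]` (helper file
`CollisionIsometryCLTMacroClosureEngineTrajectoryIntegrableA`, registered helper `engine_trajectoryIntegrable_pieces`).
The finitely many windows are glued by induction on the collision set (as in the (B1) file).
-/

noncomputable section

open MeasureTheory Filter Set Topology InformationTheory
open scoped ENNReal ContDiff

namespace Summit.AtomisticToContinuum.HydrodynamicLimit.Theorems.MacroClosureLine

open Literature.MathematicalPhysics.KineticTheory Literature.Analysis.FluidPDE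
open Literature.Analysis.FunctionSpaces
open Summit.AtomisticToContinuum.HydrodynamicLimit.Theses

namespace Barycentric

namespace EngineTrajectoryIntegrable

/-! ## Hard-sphere trajectories: gluing collision-free windows, frozen velocities -/

section Trajectory

variable {N : ℕ} {ε : ℝ} {γ : ℝ → Config (N + 1) (Fin 3) T3}

/-- **Gluing collision-free windows.** A function integrable on every collision-free open window
`(a, b) ⊆ [0, t]` of a hard-sphere trajectory is integrable on `[0, t]` (induction on the finite set of
collision times in `[0, t]`, as `traj_intervalIntegrable` of the (B1) file). -/
theorem integrableOn_Icc_of_pieces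
    (hγ : IsHardSphereTrajectory (Torus.geometry (Fin 3)) ε (N + 1) γ) {t : ℝ} (ht : 0 ≤ t)
    {f : ℝ → ℝ} (hf : ∀ a b : ℝ, 0 ≤ a → a < b → b ≤ t →
      (∀ τ ∈ Ioo a b, τ ∉ collisionTimes (Torus.geometry (Fin 3)) ε γ) → IntegrableOn f (Ioo a b)) :
    IntegrableOn f (Icc 0 t) := by
  classical
  suffices H : ∀ (D : Finset ℝ) (a b : ℝ), 0 ≤ a → a ≤ b → b ≤ t →
      (∀ c ∈ Ioo a b, c ∈ collisionTimes (Torus.geometry (Fin 3)) ε γ → c ∈ D) →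
      IntervalIntegrable f volume a b by
    exact (intervalIntegrable_iff_integrableOn_Icc_of_le ht).1
      (H (hγ.locFinite 0 t).toFinset 0 t le_rfl ht le_rfl fun c hc hcC =>
        (hγ.locFinite 0 t).mem_toFinset.2 ⟨hcC, hc.1.le, hc.2.le⟩)
  intro D
  induction D using Finset.induction_on with
  | empty =>
    intro a b ha hab hb hD
    rcases hab.eq_or_lt with rfl | hab'
    · exact IntervalIntegrable.refl
    · exact (intervalIntegrable_iff_integrableOn_Ioo_of_le hab).2
        (hf a b ha hab' hb fun c hc hcC => by simpa using hD c hc hcC)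
  | @insert c D _ ih =>
    intro a b ha hab hb hD
    by_cases hc : c ∈ Ioo a b
    · refine (ih a c ha hc.1.le (hc.2.le.trans hb) fun c' hc' hc'C => ?_).trans
        (ih c b (ha.trans hc.1.le) hc.2.le hb fun c' hc' hc'C => ?_)
      · exact (Finset.mem_insert.1 (hD c' ⟨hc'.1, hc'.2.trans hc.2⟩ hc'C)).resolve_left
          (ne_of_lt hc'.2)
      · exact (Finset.mem_insert.1 (hD c' ⟨hc.1.trans hc'.1, hc'.2⟩ hc'C)).resolve_left
          (ne_of_gt hc'.1)
    · exact ih a b ha hab hb fun c' hc' hc'C =>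
        (Finset.mem_insert.1 (hD c' hc' hc'C)).resolve_left fun h => hc (h ▸ hc')

/-- **Frozen velocities on a collision-free window.** On a collision-free `(a, b)` the trajectory agrees
with a CONTINUOUS path of configurations (positions clamped to `[a, b]`, velocities frozen at the midpoint),
whose positions at every time are those of the trajectory at some time of `[a, b]`. -/
theorem exists_frozen (hγ : IsHardSphereTrajectory (Torus.geometry (Fin 3)) ε (N + 1) γ) {a b : ℝ}
    (hab : a < b) (hfree : ∀ τ ∈ Ioo a b, τ ∉ collisionTimes (Torus.geometry (Fin 3)) ε γ) :
    ∃ W : ℝ → Config (N + 1) (Fin 3) T3, Continuous W ∧ (∀ s ∈ Ioo a b, γ s = W s) ∧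
      ∀ s, ∃ τ ∈ Icc a b, ∀ i, (W s i).1 = (γ τ i).1 := by
  have hcl : Continuous fun s : ℝ => max a (min s b) :=
    continuous_const.max (continuous_id.min continuous_const)
  refine ⟨fun s i => ((γ (max a (min s b)) i).1, (γ ((a + b) / 2) i).2), ?_, ?_, ?_⟩
  · exact continuous_pi fun i => ((hγ.pos_continuous i).comp hcl).prodMk continuous_const
  · intro s hs
    have hm : (a + b) / 2 ∈ Ioo a b := ⟨by linarith [hs.1, hs.2], by linarith [hs.1, hs.2]⟩
    have hc : max a (min s b) = s := by rw [min_eq_left hs.2.le, max_eq_right hs.1.le]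
    funext i
    simp only [hc]
    rw [← traj_vel_eq_of_free hγ hfree hm hs i]
  · intro s
    exact ⟨max a (min s b), ⟨le_max_left _ _, max_le hab.le (min_le_right _ _)⟩, fun i => rfl⟩

end Trajectory

end EngineTrajectoryIntegrable

open EngineTrajectoryIntegrable in
/-- **`engine_trajectoryIntegrable` (registered sub-goal S2a of the lead's `engine_incrementBound`):
time-integrability along one good trajectory.** For a classical solution in the chamber of
`ThermoChamber η₃`, `0 < t < T`, a band floor `c₁`, a smooth kernel `φ` and a good trajectory
`τ ↦ Φ_τ z` whose blocks stay in the band on `[0, t]`, the seven functionals of the increment bound —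
`prodBlock(τ, Φ_τ z)`, `prodCl(τ)`, `kinFlux(τ, Φ_τ z)`, `∫ₓ ccClosure`, the kinetic defect
`∫ₓ (Σ D² + |q|²)`, `⟨emp, 1 + |v|³⟩` and `⟨emp, e^{λ|v|²}⟩` (every `λ`) — are integrable on `[0, t]`
(continuity of `prodCl`; particle-wise integrability of velocity functionals; frozen velocities on
collision-free windows, joint continuity of the block fields, bounded measurable block pressure and
Fubini for the block functionals). -/
theorem engine_trajectoryIntegrable : ∀ (σ : ℝ), 0 < σ → σ < 2⁻¹ → StiffCollisionalRelaxation.HsFreeEnergyConvex → ∀ (T : ℝ) (ρ θ : ℝ → T3 → ℝ) (u : ℝ → T3 → V3), IsHardSphereEulerSolution σ T ρ u θ → ∀ η₃ : ℝ, ThermoChamber η₃ → (∀ s ∈ Ico 0 T, ∀ x, ρ s x * σ ^ 3 < η₃) → ∀ t : ℝ, 0 < t → t < T → ∀ c₁ : ℝ, 0 < c₁ → c₁ * σ ^ 3 ≤ 1 → ∀ (N : ℕ) (Φ : Flow σ N) (φ : T3 → ℝ), Torus.IsSmooth φ → (∀ y, 0 ≤ φ y) → ∫ y, φ y = 1 →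 ∀ z ∈ Φ.good, (∀ τ ∈ Icc 0 t, ∀ x, c₁ ≤ bρ φ (Φ.flow τ z) x ∧ bρ φ (Φ.flow τ z) x * σ ^ 3 ≤ 1) → IntegrableOn (fun τ => prodBlock σ T ρ θ u φ τ (Φ.flow τ z)) (Icc 0 t) ∧ IntegrableOn (fun τ => prodCl σ T ρ θ u τ) (Icc 0 t) ∧ IntegrableOn (fun τ => kinFlux σ ρ θ u τ (Φ.flow τ z)) (Icc 0 t) ∧ IntegrableOn (fun τ => ∫ x, ccClosure σ θ u φ τ (Φ.flow τ z) x) (Icc 0 t) ∧ IntegrableOn (fun τ => ∫ x, ((∑ j, ∑ k, bD φ (Φ.flow τ z) x j k ^ 2) + ‖bq φ (Φ.flow τ z) x‖ ^ 2)) (Icc 0 t) ∧ IntegrableOn (fun τ => ∫ y, (1 + ‖y.2‖ ^ 3) ∂(empiricalMeasure (Φ.flow τ z))) (Icc 0 t) ∧ ∀ lam : ℝ, IntegrableOn (fun τ => ∫ y, Real.exp (lam * ‖y.2‖ ^ 2) ∂(empiricalMeasure (Φ.flow τ z))) (Icc 0 t) := by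
  intro σ hσ _hσ2 hH T ρ θ u hE η₃ hT hpack t ht htT c₁ hc₁ _hc₁σ N Φ φ hφ _hφ0 _hφ1 z hz hband
  obtain ⟨hΛ, h0, hM, hEE, -⟩ := EngineBlockClosure.lam_smooth hσ hE hT hpack
  have hU : UniqueDiffOn ℝ (Ico (0 : ℝ) T) := uniqueDiffOn_Ico 0 T
  have hφc : Continuous φ := hφ.continuous
  have hγ : IsHardSphereTrajectory (Torus.geometry (Fin 3)) (hsDiameter σ N) (N + 1)
      fun s => Φ.flow s z :=
    Φ.isTrajectory z hz
  -- the block functionals on a collision-free window, along the frozen path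
  have hpiece : ∀ a b : ℝ, 0 ≤ a → a < b → b ≤ t →
      (∀ τ ∈ Ioo a b, τ ∉ collisionTimes (Torus.geometry (Fin 3)) (hsDiameter σ N) fun s => Φ.flow s z) →
      ∃ W : ℝ → Config (N + 1) (Fin 3) T3, (∀ s ∈ Ioo a b, Φ.flow s z = W s) ∧
        IntegrableOn (fun s => prodBlock σ T ρ θ u φ s (W s)) (Icc a b) ∧
        IntegrableOn (fun s => ∫ x, ccClosure σ θ u φ s (W s) x) (Icc a b) ∧
        IntegrableOn (fun s => ∫ x, ((∑ j, ∑ k, bD φ (W s) x j k ^ 2) + ‖bq φ (W s) x‖ ^ 2))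
          (Icc a b) := by
    intro a b ha hab hb hfree
    obtain ⟨W, hW, hγW, hWpos⟩ := exists_frozen hγ hab hfree
    have hbandW : ∀ s x, c₁ ≤ bρ φ (W s) x ∧ bρ φ (W s) x * σ ^ 3 ≤ 1 := by
      intro s x
      obtain ⟨τ, hτ, hpos⟩ := hWpos s
      have h : bρ φ (W s) x = bρ φ (Φ.flow τ z) x := by simp only [bρ_eq_sum, hpos]
      rw [h]
      exact hband τ ⟨ha.trans hτ.1, hτ.2.trans hb⟩ x
    exact ⟨W, hγW, engine_trajectoryIntegrable_pieces σ hσ hH T ρ θ u hE η₃ hT hpack t htT c₁ hc₁ N φ hφc W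
      hW hbandW a b ha hb⟩
  refine ⟨?_, ?_, ?_, ?_, ?_, ?_, ?_⟩
  · -- prodBlock
    refine integrableOn_Icc_of_pieces hγ ht.le fun a b ha hab hb hfree => ?_
    obtain ⟨W, hγW, h, -, -⟩ := hpiece a b ha hab hb hfree
    exact (h.mono_set Ioo_subset_Icc_self).congr_fun (fun s hs => by simp only [hγW s hs])
      measurableSet_Ioo
  · -- prodCl is continuous on `[0, t]`
    have hUcl : Torus.IsSmoothSpaceTimeOn (Ico 0 T) (Ucl ρ θ u) := isSmoothSpaceTimeOn_stateOf hE
    have hA : Torus.IsSmoothSpaceTimeOn (Ico 0 T)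
        (fun τ x => Torus.timeDerivWithin (Ico 0 T) (Lcl σ ρ θ u) τ x (Ucl ρ θ u τ x)) :=
      ContDiffOn.clm_apply (hΛ.timeDerivWithin hU) hUcl
    have hC : Torus.IsSmoothSpaceTimeOn (Ico 0 T)
        (fun τ x => ∑ j, Torus.partialDeriv j (Lcl σ ρ θ u τ) x (eulerFlux σ j (Ucl ρ θ u τ x))) :=
      Torus.IsSmoothSpaceTimeOn.sum fun j _ => ContDiffOn.clm_apply (hΛ.partialDeriv hU j)
        (EngineIsentropic.isSmoothSpaceTimeOn_flux hσ hT hE hpack j)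
    have hc : ContinuousOn (fun τ => prodCl σ T ρ θ u τ) (Icc 0 t) :=
      ((hA.add hC).continuousOn_integral (convex_Ico 0 T)).mono (Icc_subset_Ico_right htT)
    exact hc.integrableOn_Icc
  · -- kinFlux: particle by particle, one-sided time derivatives at interior times
    have hsub : Icc 0 t ×ˢ (univ : Set T3) ⊆ Ico 0 T ×ˢ univ :=
      prod_mono (Icc_subset_Ico_right htT) subset_rfl
    have cA0 : ContinuousOn (fun p : ℝ × T3 => Torus.timeDerivWithin (Ico 0 T) (lam0 σ ρ θ u) p.1 p.2)
        (Icc 0 t ×ˢ univ) :=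
      (continuousOn_uncurry_of_stLift (h0.timeDerivWithin hU).continuousOn_stLift).mono hsub
    have cAx : ∀ j, ContinuousOn (fun p : ℝ × T3 => Torus.partialDeriv j (lam0 σ ρ θ u p.1) p.2)
        (Icc 0 t ×ˢ univ) := fun j =>
      (continuousOn_uncurry_of_stLift (h0.partialDeriv hU j).continuousOn_stLift).mono hsub
    have cMt : ∀ j, ContinuousOn
        (fun p : ℝ × T3 => Torus.timeDerivWithin (Ico 0 T) (lamM θ u) p.1 p.2 j) (Icc 0 t ×ˢ univ) :=
      fun j => (continuousOn_uncurry_of_stLift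
        ((hM.timeDerivWithin hU).apply j).continuousOn_stLift).mono hsub
    have cEt : ContinuousOn (fun p : ℝ × T3 => Torus.timeDerivWithin (Ico 0 T) (lamE θ) p.1 p.2)
        (Icc 0 t ×ˢ univ) :=
      (continuousOn_uncurry_of_stLift (hEE.timeDerivWithin hU).continuousOn_stLift).mono hsub
    have cMx : ∀ j k, ContinuousOn
        (fun p : ℝ × T3 => Torus.partialDeriv j (fun x => lamM θ u p.1 x k) p.2) (Icc 0 t ×ˢ univ) :=
      fun j k => (continuousOn_uncurry_of_stLift
        ((hM.apply k).partialDeriv hU j).continuousOn_stLift).mono hsub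
    have cEx : ∀ j, ContinuousOn (fun p : ℝ × T3 => Torus.partialDeriv j (lamE θ p.1) p.2)
        (Icc 0 t ×ˢ univ) := fun j =>
      (continuousOn_uncurry_of_stLift (hEE.partialDeriv hU j).continuousOn_stLift).mono hsub
    have hI : IntegrableOn (fun s => ∫ y, (Torus.timeDerivWithin (Ico 0 T) (lam0 σ ρ θ u) s y.1 +
        (∑ j, y.2 j * Torus.partialDeriv j (lam0 σ ρ θ u s) y.1) +
        (∑ j, Torus.timeDerivWithin (Ico 0 T) (lamM θ u) s y.1 j * y.2 j) +
        Torus.timeDerivWithin (Ico 0 T) (lamE θ) s y.1 * (‖y.2‖ ^ 2 / 2) +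
        (∑ j, ∑ k, Torus.partialDeriv j (fun x => lamM θ u s x k) y.1 * (y.2 j * y.2 k)) +
        ∑ j, Torus.partialDeriv j (lamE θ s) y.1 * (y.2 j * (‖y.2‖ ^ 2 / 2)))
        ∂(empiricalMeasure (Φ.flow s z))) (Icc 0 t) := by
      simp only [integral_empiricalMeasure]
      refine Integrable.const_mul (integrable_finsetSum _ fun i _ => ?_) _
      refine (intervalIntegrable_iff_integrableOn_Icc_of_le ht.le).1
        (traj_intervalIntegrable_vel hγ (t := t) (F := fun v s x =>
          Torus.timeDerivWithin (Ico 0 T) (lam0 σ ρ θ u) s x +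
          (∑ j, v j * Torus.partialDeriv j (lam0 σ ρ θ u s) x) +
          (∑ j, Torus.timeDerivWithin (Ico 0 T) (lamM θ u) s x j * v j) +
          Torus.timeDerivWithin (Ico 0 T) (lamE θ) s x * (‖v‖ ^ 2 / 2) +
          (∑ j, ∑ k, Torus.partialDeriv j (fun y => lamM θ u s y k) x * (v j * v k)) +
          ∑ j, Torus.partialDeriv j (lamE θ s) x * (v j * (‖v‖ ^ 2 / 2))) (fun v => ?_) i
          ⟨ht.le, le_rfl⟩)
      exact ((((cA0.add (continuousOn_finsetSum _ fun j _ => continuousOn_const.mul (cAx j))).add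
        (continuousOn_finsetSum _ fun j _ => (cMt j).mul continuousOn_const)).add
        (cEt.mul continuousOn_const)).add
        (continuousOn_finsetSum _ fun j _ => continuousOn_finsetSum _ fun k _ =>
          (cMx j k).mul continuousOn_const)).add
        (continuousOn_finsetSum _ fun j _ => (cEx j).mul continuousOn_const)
    rw [integrableOn_Icc_iff_integrableOn_Ioo] at hI ⊢
    exact hI.congr_fun (fun s hs => (EngineBlockClosure.kinFlux_eq ⟨hs.1, hs.2.trans htT⟩ _).symm)
      measurableSet_Ioo
  · -- the collisional closure
    refine integrableOn_Icc_of_pieces hγ ht.le fun a b ha hab hb hfree => ?_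
    obtain ⟨W, hγW, -, h, -⟩ := hpiece a b ha hab hb hfree
    exact (h.mono_set Ioo_subset_Icc_self).congr_fun (fun s hs => by simp only [hγW s hs])
      measurableSet_Ioo
  · -- the kinetic defect
    refine integrableOn_Icc_of_pieces hγ ht.le fun a b ha hab hb hfree => ?_
    obtain ⟨W, hγW, -, -, h⟩ := hpiece a b ha hab hb hfree
    exact (h.mono_set Ioo_subset_Icc_self).congr_fun (fun s hs => by simp only [hγW s hs])
      measurableSet_Ioo
  · -- `⟨emp, 1 + |v|³⟩`
    simp only [integral_empiricalMeasure]
    refine Integrable.const_mul (integrable_finsetSum _ fun i _ => ?_) _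
    exact (intervalIntegrable_iff_integrableOn_Icc_of_le ht.le).1
      (traj_intervalIntegrable_vel hγ (t := t) (F := fun v _ _ => 1 + ‖v‖ ^ 3)
        (fun _ => continuousOn_const) i ⟨ht.le, le_rfl⟩)
  · -- `⟨emp, e^{λ|v|²}⟩`
    intro lam
    simp only [integral_empiricalMeasure]
    refine Integrable.const_mul (integrable_finsetSum _ fun i _ => ?_) _
    exact (intervalIntegrable_iff_integrableOn_Icc_of_le ht.le).1
      (traj_intervalIntegrable_vel hγ (t := t) (F := fun v _ _ => Real.exp (lam * ‖v‖ ^ 2))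
        (fun _ => continuousOn_const) i ⟨ht.le, le_rfl⟩)

end Barycentric

end Summit.AtomisticToContinuum.HydrodynamicLimit.Theorems.MacroClosureLine

end
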